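import Literature.NumberTheory.LFunctions.HalaszMeanSquare
import Mathlib.NumberTheory.LSeries.Dirichlet
import HarnessLib

/-!
# Montgomery–Vaughan 2001: the window mean square of `ζ'/ζ` on `Re s = 1 + α`

Support file (everything PROVED, no definitions, no named facts) for the discharge of
`Literature.Barriers.RiemannHypothesis.MontgomeryVaughan2001_zeroFree`. In the proof of their
logarithmic mean value theorem (Roy–Vatwani 2019, §6.1, after (eq:(15) of MV)), Montgomery–Vaughan
need, uniformly in the position `T` of a unit window,

`∫_{T−1/2}^{T+1/2} |F'/F(1+α+it)|² dt ≪ 1/α`   (`F = ζ`, `0 < α ≤ 1`),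

which they obtain from their majorant principle (15) and `∫_{−1/2}^{1/2} |ζ'/ζ(1+α+it)|² dt ≪ 1/α`.
Here the same uniform bound is PROVED by the device of Granville–Soundararajan 2003, §3b (already
formalised in the tree, `HalaszMeanSquare.meanSquare_mulVM_le`): by the Mellin–Plancherel identity
(`MellinPlancherel.integral_norm_sq_psum_exp`) for the twisted coefficients `Λ(n) n^{−iT}`,

`∫_ℝ |ζ'/ζ(1+α+i(T+y))|² / |1+α+iy|² dy = 2π ∫_ℝ |∑_{n ≤ e^u} Λ(n) n^{−iT}|² e^{−2(1+α)u} du ≤ 2π ∫₀^∞ ψ(e^u)² e^{−2(1+α)u} du ≤ 36π/α`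

(Chebyshev: `ψ(x) ≤ 6x`), and `|1+α+iy|² ≤ 17/4` on `|y| ≤ 1/2`.

## Main results (namespace `Literature.NumberTheory.LFunctions.MontgomeryVaughan2001`)
- `norm_psum_twistedVM_le` : `|∑_{n ≤ y} Λ(n) n^{−iT}| ≤ ψ(y) ≤ 6y`.
- `LSeries_twistedVM_eq` : `L(Λ n^{−iT}, s) = −ζ'/ζ(s + iT)` (`Re s > 1`).
- `integral_norm_logDeriv_zeta_sq_div_le` : `∫_ℝ |ζ'/ζ(1+α+i(T+y))|²/|1+α+iy|² dy ≤ 36π/α`.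
- `window_integral_norm_logDeriv_zeta_sq_le` : `∫_{T−1/2}^{T+1/2} |ζ'/ζ(1+α+iy)|² dy ≤ 500/α`
  (`0 < α ≤ 1`, all real `T`).

## References
- [RoyVatwani2019] A. Roy, A. Vatwani, *Zeros of partial sums of L-functions*, Adv. Math. 346
  (2019), §6.1, displays (eq:(15) of MV)–(eq:intg bound) (arXiv p. 14).
- [GranvilleSoundararajan2003] A. Granville, K. Soundararajan, *Decay of mean values of
  multiplicative functions*, Canad. J. Math. 55 (2003), §3b (display before (3.14)).
-/

noncomputable section

open Complex Real MeasureTheory Set Filter Finset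

namespace Literature.NumberTheory.LFunctions.MontgomeryVaughan2001

open MellinPlancherel (psum)
open scoped ArithmeticFunction.vonMangoldt

/-! ### The twisted von Mangoldt coefficients `Λ(n) n^{−iT}` -/

/-- `‖n^{−iT}‖ = 1` for `n ≥ 1`. [folklore] -/
theorem norm_natCast_cpow_neg_mul_I {n : ℕ} (hn : 0 < n) (T : ℝ) :
    ‖(n : ℂ) ^ (-(T * I))‖ = 1 := by
  rw [Complex.norm_natCast_cpow_of_pos hn]
  simp

/-- `‖Λ(n) n^{−iT}‖ = Λ(n)`. [folklore] -/
theorem norm_twistedVM (T : ℝ) (n : ℕ) : ‖(Λ n : ℂ) * (n : ℂ) ^ (-(T * I))‖ = Λ n := by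
  rcases Nat.eq_zero_or_pos n with rfl | hn
  · simp
  · rw [norm_mul, norm_natCast_cpow_neg_mul_I hn, mul_one, Complex.norm_real, Real.norm_eq_abs,
      abs_of_nonneg ArithmeticFunction.vonMangoldt_nonneg]

/-- `|∑_{n ≤ y} Λ(n) n^{−iT}| ≤ ψ(y)`. [folklore] -/
theorem norm_psum_twistedVM_le_psi (T y : ℝ) :
    ‖psum (fun n => (Λ n : ℂ) * (n : ℂ) ^ (-(T * I))) y‖ ≤ Chebyshev.psi y := by
  unfold psum
  rw [Chebyshev.psi_eq_sum_Icc]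
  calc ‖∑ n ∈ Icc 1 ⌊y⌋₊, (Λ n : ℂ) * (n : ℂ) ^ (-(T * I))‖
      ≤ ∑ n ∈ Icc 1 ⌊y⌋₊, ‖(Λ n : ℂ) * (n : ℂ) ^ (-(T * I))‖ := norm_sum_le _ _
    _ = ∑ n ∈ Icc 1 ⌊y⌋₊, Λ n := Finset.sum_congr rfl fun n _ => norm_twistedVM T n
    _ ≤ ∑ n ∈ Icc 0 ⌊y⌋₊, Λ n := by
        refine Finset.sum_le_sum_of_subset_of_nonneg (fun n hn => ?_)
          (fun _ _ _ => ArithmeticFunction.vonMangoldt_nonneg)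
        simp only [Finset.mem_Icc] at hn ⊢
        exact ⟨by omega, hn.2⟩

/-- `|∑_{n ≤ y} Λ(n) n^{−iT}| ≤ 6 y` for `y ≥ 1` (Chebyshev, `ψ(y) ≤ (log 4 + 4) y`). [folklore] -/
theorem norm_psum_twistedVM_le (T y : ℝ) (hy : 1 ≤ y) :
    ‖psum (fun n => (Λ n : ℂ) * (n : ℂ) ^ (-(T * I))) y‖ ≤ 6 * y ^ (1 : ℝ) := by
  rw [Real.rpow_one]
  refine (norm_psum_twistedVM_le_psi T y).trans
    ((Chebyshev.psi_le_const_mul_self (by linarith)).trans ?_)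
  have h4 : Real.log 4 ≤ 2 := by
    have h2 : Real.log 4 = 2 * Real.log 2 := by
      rw [show (4:ℝ) = 2 ^ 2 by norm_num, Real.log_pow]; ring
    rw [h2]; linarith [Real.log_two_lt_d9]
  nlinarith

/-- `∑ Λ(n) n^{−σ} < ∞` for `σ > 1`, in the form consumed by `MellinPlancherel`. [folklore] -/
theorem summable_norm_twistedVM_div_rpow (T : ℝ) {σ : ℝ} (hσ : 1 < σ) :
    Summable fun n : ℕ => ‖(Λ n : ℂ) * (n : ℂ) ^ (-(T * I))‖ / (n : ℝ) ^ σ := by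
  have h := (ArithmeticFunction.LSeriesSummable_vonMangoldt (s := (σ : ℂ)) (by simpa using hσ)).norm
  refine h.congr fun n => ?_
  rcases Nat.eq_zero_or_pos n with rfl | hn
  · simp
  · rw [LSeries.norm_term_eq, if_neg hn.ne', Complex.ofReal_re, norm_twistedVM, Complex.norm_real,
      Real.norm_eq_abs, abs_of_nonneg ArithmeticFunction.vonMangoldt_nonneg]

/-- The twist shifts the variable: `term (Λ n^{−iT}) s n = term Λ (s + iT) n`. [folklore] -/
theorem term_twistedVM_eq (T : ℝ) (s : ℂ) (n : ℕ) :
    LSeries.term (fun n => (Λ n : ℂ) * (n : ℂ) ^ (-(T * I))) s n = LSeries.term (fun n => (Λ n : ℂ)) (s + T * I) n := by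
  rcases Nat.eq_zero_or_pos n with rfl | hn
  · simp
  · have hn0 : (n : ℂ) ≠ 0 := by exact_mod_cast hn.ne'
    rw [LSeries.term_of_ne_zero hn.ne', LSeries.term_of_ne_zero hn.ne', Complex.cpow_add _ _ hn0,
      Complex.cpow_neg]
    field_simp

/-- **The twisted series is a shifted logarithmic derivative**: for `Re s > 1`,
`∑ Λ(n) n^{−iT} n^{−s} = −ζ'/ζ(s + iT)`. [folklore] -/
theorem LSeries_twistedVM_eq (T : ℝ) {s : ℂ} (hs : 1 < s.re) :
    LSeries (fun n => (Λ n : ℂ) * (n : ℂ) ^ (-(T * I))) s =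
      -deriv riemannZeta (s + T * I) / riemannZeta (s + T * I) := by
  have hs' : 1 < (s + T * I).re := by simpa using hs
  rw [← ArithmeticFunction.LSeries_vonMangoldt_eq_deriv_riemannZeta_div hs', LSeries, LSeries]
  exact tsum_congr fun n => term_twistedVM_eq T s n

/-- On the line `Re s = 1 + α`: `L(Λ n^{−iT}, 1+α+iy) = −ζ'/ζ(1+α+i(T+y))`. [folklore] -/
theorem LSeries_twistedVM_line (T : ℝ) {α : ℝ} (hα : 0 < α) (y : ℝ) :
    LSeries (fun n => (Λ n : ℂ) * (n : ℂ) ^ (-(T * I))) ((1 + α : ℝ) + y * I) =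
      -(deriv riemannZeta (1 + α + (T + y) * I) / riemannZeta (1 + α + (T + y) * I)) := by
  have hpt : ((1 + α : ℝ) : ℂ) + y * I + T * I = 1 + α + (T + y) * I := by push_cast; ring
  rw [LSeries_twistedVM_eq T (by simp; linarith), hpt, neg_div]

/-! ### The mean square of the partial sums and Mellin–Plancherel -/

/-- **The `Λ`-weighted mean square** (Granville–Soundararajan's device):
`∫ |∑_{n ≤ e^u} Λ(n) n^{−iT}|² e^{−2(1+α)u} du ≤ 18/α` (`α > 0`), from `ψ(y) ≤ 6y`.
[cite: GranvilleSoundararajan2003, §3b (display before (3.14))] -/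
theorem meanSquare_twistedVM_le (T : ℝ) {α : ℝ} (hα : 0 < α) :
    ∫ u : ℝ, ‖psum (fun n => (Λ n : ℂ) * (n : ℂ) ^ (-(T * I))) (Real.exp u)‖ ^ 2 *
        Real.exp (-(2 * (1 + α) * u)) ≤ 18 / α := by
  set a : ℕ → ℂ := fun n => (Λ n : ℂ) * (n : ℂ) ^ (-(T * I)) with ha
  set F : ℝ → ℝ := (Set.Ici (0 : ℝ)).indicator (fun u => 36 * Real.exp (-(2 * α) * u)) with hF
  have hIoi : IntegrableOn (fun u => 36 * Real.exp (-(2 * α) * u)) (Set.Ioi (0 : ℝ)) :=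
    (integrableOn_exp_mul_Ioi (by linarith : -(2 * α) < 0) 0).const_mul 36
  have hIci : IntegrableOn (fun u => 36 * Real.exp (-(2 * α) * u)) (Set.Ici (0 : ℝ)) :=
    (integrableOn_Ici_iff_integrableOn_Ioi).2 hIoi
  have hFint : Integrable F := by
    rw [hF, integrable_indicator_iff measurableSet_Ici]
    exact hIci
  have hle : ∀ u : ℝ, ‖psum a (Real.exp u)‖ ^ 2 * Real.exp (-(2 * (1 + α) * u)) ≤ F u := by
    intro u
    by_cases hu : 0 ≤ u
    · rw [hF, Set.indicator_of_mem (Set.mem_Ici.2 hu)]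
      have h1 : (1 : ℝ) ≤ Real.exp u := by simpa using Real.one_le_exp hu
      have hb := norm_psum_twistedVM_le T (Real.exp u) h1
      rw [Real.rpow_one] at hb
      have hexp : (6 * Real.exp u) ^ 2 * Real.exp (-(2 * (1 + α) * u)) =
          36 * Real.exp (-(2 * α) * u) := by
        rw [mul_pow, sq (Real.exp u), ← Real.exp_add, mul_assoc, ← Real.exp_add]
        congr 1
        · norm_num
        · congr 1; ring
      calc ‖psum a (Real.exp u)‖ ^ 2 * Real.exp (-(2 * (1 + α) * u))
          ≤ (6 * Real.exp u) ^ 2 * Real.exp (-(2 * (1 + α) * u)) := by gcongr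
        _ = 36 * Real.exp (-(2 * α) * u) := hexp
    · push Not at hu
      rw [hF, Set.indicator_of_notMem (by simpa using hu),
        MellinPlancherel.psum_of_lt_one _ (by simpa using Real.exp_lt_one_iff.mpr hu)]
      simp
  have hnonneg : 0 ≤ᵐ[volume] fun u : ℝ => ‖psum a (Real.exp u)‖ ^ 2 * Real.exp (-(2 * (1 + α) * u)) :=
    Filter.Eventually.of_forall fun u => by positivity
  calc ∫ u : ℝ, ‖psum a (Real.exp u)‖ ^ 2 * Real.exp (-(2 * (1 + α) * u))
      ≤ ∫ u, F u := integral_mono_of_nonneg hnonneg hFint (Filter.Eventually.of_forall hle)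
    _ = 36 * (1 / (2 * α)) := by
        rw [hF, integral_indicator measurableSet_Ici, integral_Ici_eq_integral_Ioi,
          integral_const_mul, integral_exp_mul_Ioi (by linarith : -(2 * α) < 0) 0]
        congr 1
        simp only [mul_zero, Real.exp_zero]
        field_simp
    _ = 18 / α := by field_simp; ring

/-- **The weighted mean square of `ζ'/ζ` on `Re s = 1 + α`, uniformly in the height `T`**:
`∫_ℝ |ζ'/ζ(1 + α + i(T+y))|² / |1 + α + iy|² dy ≤ 36π/α` (`α > 0`), by Mellin–Plancherel for the
twisted coefficients `Λ(n) n^{−iT}` and the previous lemma.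
[cite: RoyVatwani2019, §6.1 display (eq:intg bound)] -/
theorem integral_norm_logDeriv_zeta_sq_div_le (T : ℝ) {α : ℝ} (hα : 0 < α) :
    ∫ y : ℝ, ‖deriv riemannZeta (1 + α + (T + y) * I) / riemannZeta (1 + α + (T + y) * I)‖ ^ 2 /
        ‖(1 : ℂ) + α + y * I‖ ^ 2 ≤ 36 * π / α := by
  set a : ℕ → ℂ := fun n => (Λ n : ℂ) * (n : ℂ) ^ (-(T * I)) with ha
  have hσ : (0 : ℝ) < 1 + α := by linarith
  have hP := MellinPlancherel.integral_norm_sq_psum_exp (a := a) (σ := 1 + α) (θ := 1) (C := 6) hσ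
    (summable_norm_twistedVM_div_rpow T (by linarith)) (by linarith)
    (fun y hy => norm_psum_twistedVM_le T y hy)
  have hM := meanSquare_twistedVM_le T hα
  -- identify the integrand
  have heq : (fun y : ℝ => ‖LSeries a ((1 + α : ℝ) + y * I)‖ ^ 2 / ‖(((1 + α : ℝ)) : ℂ) + y * I‖ ^ 2) =
      fun y : ℝ => ‖deriv riemannZeta (1 + α + (T + y) * I) / riemannZeta (1 + α + (T + y) * I)‖ ^ 2 /
        ‖(1 : ℂ) + α + y * I‖ ^ 2 := by
    funext y
    rw [LSeries_twistedVM_line T hα y, norm_neg]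
    push_cast
    rfl
  rw [heq] at hP
  have hπ : 0 < 2 * π := by positivity
  -- `(1/2π) ∫ … = ∫ |psum|² e^{…} ≤ 18/α`
  have h1 : (1 / (2 * π)) * ∫ y : ℝ, ‖deriv riemannZeta (1 + α + (T + y) * I) /
      riemannZeta (1 + α + (T + y) * I)‖ ^ 2 / ‖(1 : ℂ) + α + y * I‖ ^ 2 ≤ 18 / α := by
    rw [← hP]
    convert hM using 3
  rw [one_div, inv_mul_le_iff₀ hπ] at h1
  have h36 : 2 * π * (18 / α) = 36 * π / α := by ring
  linarith [h1]

/-- **Window mean square of `ζ'/ζ`, uniformly in the window** (Roy–Vatwani 2019, §6.1: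
"`∫_{T−1/2}^{T+1/2} |F'/F(1+α+it)|² dt ≪ α^{−1}` uniformly for `0 < α ≤ 1`", `k = 1`, `F = ζ`):
for `0 < α ≤ 1` and every real `T`, `∫_{T−1/2}^{T+1/2} |ζ'/ζ(1+α+iy)|² dy ≤ 500/α`.
[cite: RoyVatwani2019, §6.1 (eq:(15) of MV)–(eq:intg bound)] -/
theorem window_integral_norm_logDeriv_zeta_sq_le {α : ℝ} (hα : 0 < α) (hα1 : α ≤ 1) (T : ℝ) :
    ∫ y in (T - 1 / 2)..(T + 1 / 2),
        ‖deriv riemannZeta (1 + α + y * I) / riemannZeta (1 + α + y * I)‖ ^ 2 ≤ 500 / α := by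
  set G : ℝ → ℝ := fun y => ‖deriv riemannZeta (1 + α + (T + y) * I) /
      riemannZeta (1 + α + (T + y) * I)‖ ^ 2 / ‖(1 : ℂ) + α + y * I‖ ^ 2 with hG
  -- integrability of the weighted integrand (from the tree)
  have hint : Integrable G := by
    have h := Halasz.integrable_norm_LSeries_sq_div (a := fun n => (Λ n : ℂ) * (n : ℂ) ^ (-(T * I)))
      (σ := 1 + α) (by linarith) (summable_norm_twistedVM_div_rpow T (by linarith))
    refine h.congr (Filter.Eventually.of_forall fun y => ?_)
    simp only [hG]
    rw [LSeries_twistedVM_line T hα y, norm_neg]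
    push_cast
    rfl
  have hGnn : 0 ≤ᵐ[volume] G := Filter.Eventually.of_forall fun y => by simp only [hG]; positivity
  have hwhole := integral_norm_logDeriv_zeta_sq_div_le T hα
  -- shift the window to `[-1/2, 1/2]`
  set g : ℝ → ℝ := fun y => ‖deriv riemannZeta (1 + α + y * I) / riemannZeta (1 + α + y * I)‖ ^ 2
    with hg
  have hshift : ∫ y in (T - 1 / 2)..(T + 1 / 2), g y = ∫ y in (-(1 / 2) : ℝ)..(1 / 2), g (T + y) := by
    rw [intervalIntegral.integral_comp_add_left g T, show T + -(1 / 2) = T - 1 / 2 by ring]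
  have hgT : ∀ y : ℝ, g (T + y) =
      ‖deriv riemannZeta (1 + α + (T + y) * I) / riemannZeta (1 + α + (T + y) * I)‖ ^ 2 := by
    intro y; simp only [hg]; push_cast; rfl
  change ∫ y in (T - 1 / 2)..(T + 1 / 2), g y ≤ 500 / α
  rw [hshift]
  simp_rw [hgT]
  -- on the window the weight is at least `4/17`
  have hptw : ∀ y ∈ Set.Icc (-(1 / 2) : ℝ) (1 / 2),
      ‖deriv riemannZeta (1 + α + (T + y) * I) / riemannZeta (1 + α + (T + y) * I)‖ ^ 2 ≤
        (17 / 4) * G y := by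
    intro y hy
    simp only [hG]
    have hden : ‖(1 : ℂ) + α + y * I‖ ^ 2 ≤ 17 / 4 := by
      rw [Complex.sq_norm, Complex.normSq_apply]
      simp
      rw [Set.mem_Icc] at hy
      nlinarith [hy.1, hy.2]
    have hpos : 0 < ‖(1 : ℂ) + α + y * I‖ ^ 2 := by
      have : ((1 : ℂ) + α + y * I) ≠ 0 := by
        intro h
        have := congrArg Complex.re h
        simp at this
        linarith
      positivity
    rw [mul_div_assoc', le_div_iff₀ hpos]
    nlinarith [sq_nonneg ‖deriv riemannZeta (1 + α + (T + y) * I) / riemannZeta (1 + α + (T + y) * I)‖]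
  calc ∫ y in (-(1 / 2) : ℝ)..(1 / 2),
        ‖deriv riemannZeta (1 + α + (T + y) * I) / riemannZeta (1 + α + (T + y) * I)‖ ^ 2
      ≤ ∫ y in (-(1 / 2) : ℝ)..(1 / 2), (17 / 4) * G y := by
        refine intervalIntegral.integral_mono_on (by norm_num) ?_ ?_ hptw
        · refine (Continuous.intervalIntegrable ?_ _ _)
          have hc : Continuous fun y : ℝ => LSeries (fun n => (Λ n : ℂ) * (n : ℂ) ^ (-(T * I)))
              ((1 + α : ℝ) + y * I) :=
            Halasz.continuous_LSeries_line (summable_norm_twistedVM_div_rpow T (by linarith))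
          have heq : (fun y : ℝ => ‖deriv riemannZeta (1 + α + (T + y) * I) /
              riemannZeta (1 + α + (T + y) * I)‖ ^ 2) = fun y : ℝ =>
              ‖LSeries (fun n => (Λ n : ℂ) * (n : ℂ) ^ (-(T * I))) ((1 + α : ℝ) + y * I)‖ ^ 2 := by
            funext y
            rw [LSeries_twistedVM_line T hα y, norm_neg]
          rw [heq]
          exact (hc.norm).pow 2
        · exact (hint.const_mul _).intervalIntegrable
    _ = (17 / 4) * ∫ y in (-(1 / 2) : ℝ)..(1 / 2), G y := by
        rw [intervalIntegral.integral_const_mul]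
    _ ≤ (17 / 4) * ∫ y, G y := by
        gcongr
        rw [intervalIntegral.integral_of_le (by norm_num)]
        exact setIntegral_le_integral hint hGnn
    _ ≤ (17 / 4) * (36 * π / α) := by gcongr
    _ ≤ 500 / α := by
        rw [mul_div_assoc', div_le_div_iff_of_pos_right hα]
        nlinarith [Real.pi_lt_d2]

end Literature.NumberTheory.LFunctions.MontgomeryVaughan2001
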